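import Mathlib
import Summits.ValiantsHypothesis.ValiantsHypothesis.Theorems.TwoProducts.Negative.RankTwoEscapes
import Summits.ValiantsHypothesis.ValiantsHypothesis.Theorems.TwoProducts.Negative.CommonPadding
import HarnessLib

/-!
# NEGATIVE lane (val-neg-1 g5): COMMON DEEP PADDING respects the CLASS-COVER threshold (R1_r)

Sequel to `Negative/RankTwoPadding.lean` (same seat; helper file for crux `stmt-ValiantsHypothesis-5906`, filed `--supports`; closes NO
item, proves NO summit statement, does NOT prove `TwoProducts`, `PlanarCellBound` or VP ≠ VNP; 0 `def`s).

`classCover_restrict_padding`: a cover of the coincidences of the PADDED letter family (gadget tuple `w` of `noDatum_padding_spec`) by `r`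
relation classes restricts to a cover of the coincidences of the ORIGINAL family by `r − 1` classes — the class of the planted gadget
coincidence `(4N s ∣ 0) ~ (2N s ∣ 2N s)` contains a gadget position, whereas every old coincidence padded by zeros has its difference set
inside the old positions, so it is matched by another class; reindex by `Fin.succAbove`.  `classCover_threshold_padding`: the (R1_r)
threshold inequality `2^m (t+2)^4 < 2(m+1) (3(2+m+C(m,2))²)^{r-1}` implies the padded one `2^{m+4} (t+2)^4 < 2(m+5) (3(6+m+C(m+4,2))²)^r`
(`16 · 2(m+1) ≤ 2(m+5) · 108`).  Hence the «no cheap class cover» hypothesis of the v12…v20 residuals transfers from `(u, v)` to the padded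
instance (`noCheapCover_padding`).  The cover predicate is the body of `ClassCover` of `Cruxes/TwoProducts/Lines/relation_ladder.lean`
(l. 2582), inlined token-for-token (= hypothesis `hSR` of the landed `PlanarCell.planarCell_relationClasses`).  [folklore]
-/

namespace Summit.ValiantsHypothesis.Theorems.TwoProducts.Negative.RankTwoPaddingClassCover

open Finset MvPolynomial
open Summit.ValiantsHypothesis.ValiantsHypothesis.Theorems.NewtonUnitEquations.TwoProducts.FormalLogLinearisation
open Summit.ValiantsHypothesis.ValiantsHypothesis.Theorems.NewtonUnitEquations.TwoProducts.PlanarCell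
open Summit.ValiantsHypothesis.ValiantsHypothesis.Theorems.NewtonUnitEquations.TwoProducts.PermutationType
  (msetT PermType RankOneCoincidences)
open Summit.ValiantsHypothesis.Theorems.TwoProducts.Negative.CommonPadding

variable {m : ℕ}

/-- Padding a letter tuple of `A j := supp u_j ∪ supp v_j` by four zeros gives a letter tuple of the padded family. [folklore] -/
theorem append_zero_mem_tuples (u v : Fin m → MvPolynomial (Fin 2) ℂ) (w : Fin 4 → MvPolynomial (Fin 2) ℂ)
    {a : Fin m → Expo} (ha : a ∈ tuples fun j => (u j).support ∪ (v j).support) :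
    Fin.append a (0 : Fin 4 → Expo) ∈ tuples fun j => (Fin.append u w j).support ∪ (Fin.append v w j).support := by
  rw [tuples, Fintype.mem_piFinset] at ha ⊢
  intro j
  refine Fin.addCases (fun j => ?_) (fun i => ?_) j
  · simp only [Fin.append_left]; exact ha j
  · simp only [Fin.append_right, Pi.zero_apply, Finset.mem_insert, true_or]

/-- Sum of a zero-padded tuple. [folklore] -/
theorem sum_append_zero (a : Fin m → Expo) : ∑ j, Fin.append a (0 : Fin 4 → Expo) j = ∑ j, a j := by
  rw [Fin.sum_univ_add]; simp

/-- **Class covers restrict under the padding** (one class is spent on the gadget coincidence). [folklore] -/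
theorem classCover_restrict_padding (u v : Fin m → MvPolynomial (Fin 2) ℂ) (hu0 : ∀ j, coeff 0 (u j) = 0)
    (hv0 : ∀ j, coeff 0 (v j) = 0) (hT : (tailSupport u v).Nonempty) {N : ℕ} (hN : 1 ≤ N) (w : Fin 4 → MvPolynomial (Fin 2) ℂ)
    (hw_def : w = fun i : Fin 4 =>
      if (i : ℕ) < 2 then monomial ((2 * N) • ∑ f ∈ tailSupport u v, f) (1 : ℂ) + monomial ((2 * (2 * N)) • ∑ f ∈ tailSupport u v, f) 1
      else monomial ((3 * N) • ∑ f ∈ tailSupport u v, f) (1 : ℂ) + monomial ((2 * (3 * N)) • ∑ f ∈ tailSupport u v, f) 1)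
    {r : ℕ} (Jc : Fin r → Finset (Fin (m + 4))) (ac bc : Fin r → Fin (m + 4) → Expo)
    (hcov : ∀ a ∈ tuples (fun j => (Fin.append u w j).support ∪ (Fin.append v w j).support),
      ∀ b ∈ tuples (fun j => (Fin.append u w j).support ∪ (Fin.append v w j).support), a ≠ b → ∑ j, a j = ∑ j, b j →
      ∃ k : Fin r, (∀ j, a j ≠ b j ↔ j ∈ Jc k) ∧
        ((∀ j ∈ Jc k, a j = ac k j ∧ b j = bc k j) ∨ (∀ j ∈ Jc k, a j = bc k j ∧ b j = ac k j))) :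
    ∃ (r₀ : ℕ) (Jc₀ : Fin r₀ → Finset (Fin m)) (ac₀ bc₀ : Fin r₀ → Fin m → Expo), r = r₀ + 1 ∧
      ∀ a ∈ tuples (fun j => (u j).support ∪ (v j).support), ∀ b ∈ tuples (fun j => (u j).support ∪ (v j).support),
        a ≠ b → ∑ j, a j = ∑ j, b j →
        ∃ k : Fin r₀, (∀ j, a j ≠ b j ↔ j ∈ Jc₀ k) ∧
          ((∀ j ∈ Jc₀ k, a j = ac₀ k j ∧ b j = bc₀ k j) ∨ (∀ j ∈ Jc₀ k, a j = bc₀ k j ∧ b j = ac₀ k j)) := by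
  classical
  set s : Expo := ∑ f ∈ tailSupport u v, f with hs_def
  have hs0 : s ≠ 0 := tailSum_ne_zero hu0 hv0 hT
  have h2N : 2 * N ≠ 0 := by omega
  have h01 : (Fin.natAdd m (0 : Fin 4) : Fin (m + 4)) ≠ Fin.natAdd m 1 := by simp [Fin.ext_iff]
  have hA : ∀ (i : Fin 4) (e : Expo), e ∈ (w i).support →
      e ∈ (Fin.append u w (Fin.natAdd m i)).support ∪ (Fin.append v w (Fin.natAdd m i)).support := by
    intro i e he
    rw [Fin.append_right]
    exact Finset.mem_union_left _ he
  have hw0 : w 0 = monomial ((2 * N) • s) (1 : ℂ) + monomial ((2 * (2 * N)) • s) 1 := by simp [hw_def]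
  have hw1 : w 1 = monomial ((2 * N) • s) (1 : ℂ) + monomial ((2 * (2 * N)) • s) 1 := by simp [hw_def]
  obtain ⟨hg2a, hg2b⟩ := nsmul_mem_support_gadget (s := s) hs0 h2N
  obtain ⟨ha₁, hb₁, hs₁, -, -, hne₁⟩ :=
    planted_pair (A := fun j => (Fin.append u w j).support ∪ (Fin.append v w j).support) h01 hs0 h2N
      (hA 0 _ (by rw [hw0]; exact hg2a)) (hA 0 _ (by rw [hw0]; exact hg2b)) (hA 1 _ (by rw [hw1]; exact hg2a))
  have hxy : (Pi.single (Fin.natAdd m (0 : Fin 4)) ((2 * (2 * N)) • s) + Pi.single (Fin.natAdd m (1 : Fin 4)) (0 : Expo) :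
      Fin (m + 4) → Expo) ≠ Pi.single (Fin.natAdd m (0 : Fin 4)) ((2 * N) • s) + Pi.single (Fin.natAdd m (1 : Fin 4)) ((2 * N) • s) :=
    fun h => hne₁ (by rw [h])
  obtain ⟨kstar, hks, -⟩ := hcov _ ha₁ _ hb₁ hxy hs₁
  have hp0 : Fin.natAdd m (0 : Fin 4) ∈ Jc kstar := by
    refine (hks _).1 ?_
    have d : (2 * (2 * N)) • s ≠ (2 * N) • s := nsmul_ne_nsmul hs0 (by omega)
    simpa [Pi.single_apply, h01] using d
  obtain ⟨r₀, rfl⟩ : ∃ r₀, r = r₀ + 1 := ⟨r - 1, (Nat.sub_add_cancel kstar.pos).symm⟩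
  refine ⟨r₀, fun i => Finset.univ.filter fun j => Fin.castAdd 4 j ∈ Jc (kstar.succAbove i),
    fun i j => ac (kstar.succAbove i) (Fin.castAdd 4 j), fun i j => bc (kstar.succAbove i) (Fin.castAdd 4 j), rfl, ?_⟩
  intro a ha b hb hab hsum
  have ha' := append_zero_mem_tuples u v w ha
  have hb' := append_zero_mem_tuples u v w hb
  have hne' : Fin.append a (0 : Fin 4 → Expo) ≠ Fin.append b 0 := by
    intro h
    apply hab
    funext j
    have := congr_fun h (Fin.castAdd 4 j)
    simpa only [Fin.append_left] using this
  have hsum' : ∑ j, Fin.append a (0 : Fin 4 → Expo) j = ∑ j, Fin.append b (0 : Fin 4 → Expo) j := by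
    rw [sum_append_zero, sum_append_zero, hsum]
  obtain ⟨k, hk, hpat⟩ := hcov _ ha' _ hb' hne' hsum'
  have hkne : k ≠ kstar := by
    rintro rfl
    have := (hk (Fin.natAdd m (0 : Fin 4))).2 hp0
    simp only [Fin.append_right, Pi.zero_apply, ne_eq, not_true_eq_false] at this
  obtain ⟨i, hi⟩ := Fin.exists_succAbove_eq hkne
  refine ⟨i, fun j => ?_, ?_⟩
  · rw [Finset.mem_filter, hi, ← hk (Fin.castAdd 4 j), Fin.append_left, Fin.append_left]
    simp
  · simp only [Finset.mem_filter, Finset.mem_univ, true_and, hi]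
    refine hpat.imp (fun h j hj => ?_) (fun h j hj => ?_)
    · have := h _ hj; rwa [Fin.append_left, Fin.append_left] at this
    · have := h _ hj; rwa [Fin.append_left, Fin.append_left] at this

/-- **The (R1_r) threshold survives the padding**: `m ↦ m + 4` costs a factor `16` on the left, one extra class pays `≥ 108` on the right.
[folklore] -/
theorem classCover_threshold_padding (m t r₀ : ℕ)
    (h : 2 ^ m * (t + 2) ^ 4 < 2 * (m + 1) * (3 * (2 + m + m.choose 2) ^ 2) ^ r₀) :
    2 ^ (m + 4) * (t + 2) ^ 4 < 2 * (m + 4 + 1) * (3 * (2 + (m + 4) + (m + 4).choose 2) ^ 2) ^ (r₀ + 1) := by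
  have hXY : 3 * (2 + m + m.choose 2) ^ 2 ≤ 3 * (2 + (m + 4) + (m + 4).choose 2) ^ 2 :=
    Nat.mul_le_mul_left _ (Nat.pow_le_pow_left (by have := Nat.choose_le_choose 2 (Nat.le_add_right m 4); omega) 2)
  have hY : 108 ≤ 3 * (2 + (m + 4) + (m + 4).choose 2) ^ 2 := by
    have : 6 ≤ 2 + (m + 4) + (m + 4).choose 2 := by omega
    have := Nat.pow_le_pow_left this 2
    omega
  calc 2 ^ (m + 4) * (t + 2) ^ 4 = 16 * (2 ^ m * (t + 2) ^ 4) := by ring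
    _ < 16 * (2 * (m + 1) * (3 * (2 + m + m.choose 2) ^ 2) ^ r₀) := Nat.mul_lt_mul_of_pos_left h (by norm_num)
    _ = 32 * (m + 1) * (3 * (2 + m + m.choose 2) ^ 2) ^ r₀ := by ring
    _ ≤ 2 * (m + 4 + 1) * (3 * (2 + (m + 4) + (m + 4).choose 2) ^ 2) *
          (3 * (2 + (m + 4) + (m + 4).choose 2) ^ 2) ^ r₀ :=
        Nat.mul_le_mul (by nlinarith) (Nat.pow_le_pow_left hXY r₀)
    _ = 2 * (m + 4 + 1) * (3 * (2 + (m + 4) + (m + 4).choose 2) ^ 2) ^ (r₀ + 1) := by ring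

/-- **«No cheap class cover» transfers to the padded instance.** [folklore] -/
theorem noCheapCover_padding {t : ℕ} (u v : Fin m → MvPolynomial (Fin 2) ℂ) (hu0 : ∀ j, coeff 0 (u j) = 0)
    (hv0 : ∀ j, coeff 0 (v j) = 0) (hT : (tailSupport u v).Nonempty) {N : ℕ} (hN : 1 ≤ N) (w : Fin 4 → MvPolynomial (Fin 2) ℂ)
    (hw_def : w = fun i : Fin 4 =>
      if (i : ℕ) < 2 then monomial ((2 * N) • ∑ f ∈ tailSupport u v, f) (1 : ℂ) + monomial ((2 * (2 * N)) • ∑ f ∈ tailSupport u v, f) 1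
      else monomial ((3 * N) • ∑ f ∈ tailSupport u v, f) (1 : ℂ) + monomial ((2 * (3 * N)) • ∑ f ∈ tailSupport u v, f) 1)
    (hcc : ∀ (r : ℕ) (Jc : Fin r → Finset (Fin m)) (ac bc : Fin r → Fin m → Expo),
      (∀ a ∈ tuples (fun j => (u j).support ∪ (v j).support), ∀ b ∈ tuples (fun j => (u j).support ∪ (v j).support),
        a ≠ b → ∑ j, a j = ∑ j, b j →
        ∃ k : Fin r, (∀ j, a j ≠ b j ↔ j ∈ Jc k) ∧
          ((∀ j ∈ Jc k, a j = ac k j ∧ b j = bc k j) ∨ (∀ j ∈ Jc k, a j = bc k j ∧ b j = ac k j))) →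
      2 ^ m * (t + 2) ^ 4 < 2 * (m + 1) * (3 * (2 + m + m.choose 2) ^ 2) ^ r) :
    ∀ (r : ℕ) (Jc : Fin r → Finset (Fin (m + 4))) (ac bc : Fin r → Fin (m + 4) → Expo),
      (∀ a ∈ tuples (fun j => (Fin.append u w j).support ∪ (Fin.append v w j).support),
        ∀ b ∈ tuples (fun j => (Fin.append u w j).support ∪ (Fin.append v w j).support), a ≠ b → ∑ j, a j = ∑ j, b j →
        ∃ k : Fin r, (∀ j, a j ≠ b j ↔ j ∈ Jc k) ∧
          ((∀ j ∈ Jc k, a j = ac k j ∧ b j = bc k j) ∨ (∀ j ∈ Jc k, a j = bc k j ∧ b j = ac k j))) →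
      2 ^ (m + 4) * (t + 2) ^ 4 < 2 * (m + 4 + 1) * (3 * (2 + (m + 4) + (m + 4).choose 2) ^ 2) ^ r := by
  intro r Jc ac bc hcov
  obtain ⟨r₀, Jc₀, ac₀, bc₀, rfl, hcov₀⟩ := classCover_restrict_padding u v hu0 hv0 hT hN w hw_def Jc ac bc hcov
  exact classCover_threshold_padding m t r₀ (hcc r₀ Jc₀ ac₀ bc₀ hcov₀)

end Summit.ValiantsHypothesis.Theorems.TwoProducts.Negative.RankTwoPaddingClassCover
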